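import Mathlib
import Literature.Analysis.FluidPDE.SobolevWholeSpace
import Literature.Analysis.FluidPDE.BKMClassGradientContinuity
import Literature.Analysis.FluidPDE.TaoEnstrophyLocalisation
import Literature.Analysis.FluidPDE.TaoEnstrophyLocalisationProofs
import Literature.Analysis.FluidPDE.TaoLocalisationHolds
import Literature.Analysis.FluidPDE.NSSerrinRegularityProofs
import Literature.Analysis.FluidPDE.ClassicalSolutionGlue
import HarnessLib

/-!
# Shelf crux `EnstrophyQuarterLaw` (stmt-NavierStokesRegularity-1574), line «sparse_sieve»:
# NO `L³`-CONCENTRATION BELOW THE ENSTROPHY SCALE — the `UniformSparseness` count is ZERO at scales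
# `r ≤ c₀ ε₀² / Z(t)` (unconditional, every first blow-up, every time)

Helper file (`--supports stmt-NavierStokesRegularity-1574 --as helper`) for the OPEN registered stub
`stub_uniformSparseness` (S2) of `Cruxes/EnstrophyQuarterLaw/Lines/sparse_sieve.lean`. The stub counts, at time
`t < T` and scale `r`, `4r`-separated centres `x` whose balls `B(x, 2r)` carry `∫ |u(t)|³ ≥ ε₀³`. The tree knows
the count is uniformly bounded at every scale `r ≥ r_min` (`SparsenessMacroscopic`, p816691) and at early times,
so S2 is open only as `r → 0, t → T`. This file adds the complementary UNCONDITIONAL fact at the bottom of the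
scale range: with `Z(t) = ∫ |curl u(t)|²` the enstrophy of the slice,

* `setLIntegral_ball_norm_cube_le` (static): for a divergence-free `C²` field `v` on `ℝ³` with `v, Dv, D²v ∈ L²`,
  `∫_{B(x,ϱ)} |v|³ ≤ |B(x,ϱ)|^{1/2} · K³ · (∫ |curl v|²)^{3/2}` (Hölder on the ball, `H¹ ⊂ L⁶` with the tree's
  constant `K`, `‖Dv‖_op² ≤ |Dv|_F²`, and `∫ |Dv|_F² = ∫ |curl v|²` for divergence-free decaying fields);
* `no_concentration_below_enstrophy_scale`: there is an ABSOLUTE `c₀ > 0` such that along every maximal classical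
  solution on `[0,T)`, Leray–Hopf from a rapidly decaying datum, for every `ε₀ > 0`, `t ∈ [0,T)`, centre `x` and
  radius `r > 0` with `r · Z(t) ≤ c₀ ε₀²`, the ball `B(x, 2r)` does NOT `ε₀`-concentrate:
  `∫_{B(x,2r)} |u(t)|³ < ε₀³`;
* `card_eq_zero_below_enstrophy_scale`: hence every family admissible in the S2 count at such `(t, r)` is EMPTY.

READING (census currency). Satellite swarms — the only way S2 can fail — live at scales `r` with
`c₀ ε₀² / Z(t) < r < r_min` near `t = T`: the product `r · Z(t)` of a swarm's scale with the slice enstrophy is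
bounded BELOW by the absolute multiple `c₀ ε₀²` of the threshold. Under the slice quarter law
`Z(t) ≤ K'/√(T−t)` (the crux) the empty region contains every parabolic-and-finer scale
`r ≤ c₀ ε₀² √(T−t)/K'`; unconditionally the boundary is the enstrophy scale `1/Z(t)` itself, which at an
enstrophy-Type-II blow-up is `o(√(T−t))` along a sequence of times. HONEST FRAMING: an unconditional but
ELEMENTARY bound along a HYPOTHETICAL blow-up; S2, the crux `EnstrophyQuarterLaw` (1574) and Navier–Stokes
regularity stay OPEN; no summit statement is proved.
-/

noncomputable section

-- the summit and its single sub-problem share the name (CONVENTIONS §1), as in every Theorems file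
set_option linter.dupNamespace false

namespace Summit.NavierStokesRegularity.NavierStokesRegularity.Theorems.EnstrophyQuarterLaw.EnstrophyScale

open MeasureTheory Set Metric Module
open Literature.Analysis Literature.Analysis.FluidPDE
open scoped ENNReal NNReal

/-! ### The static estimate on one ball -/

/-- **`L³` mass of a ball is controlled by the enstrophy (static).** For a divergence-free `C²` field
`v : ℝ³ → ℝ³` with `v, Dv, D²v ∈ L²` and every ball `B(x, ϱ)`:
`∫_{B(x,ϱ)} ‖v‖³ ≤ |B(x,ϱ)|^{1/2} · (K³ · (∫ ‖curl v‖²)^{3/2})`, `K = SNormLESNormFDerivOfEqConst ℝ³ volume 2` the tree's Sobolev constant.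
Hölder (`L³(B) ⊂ L⁶(B)` against `1`), the whole-space embedding `‖v‖₆ ≤ K ‖Dv‖₂`, `‖Dv(x)‖_op² ≤ |Dv(x)|_F²`
and `∫ |Dv|_F² = ∫ ‖curl v‖²`. [folklore] -/
theorem setLIntegral_ball_norm_cube_le {v : EuclideanSpace ℝ (Fin 3) → EuclideanSpace ℝ (Fin 3)}
    (hv : ContDiff ℝ 2 v) (hdiv : VectorCalculus.IsDivFree v) (h0 : ∫⁻ x, ‖v x‖ₑ ^ 2 < ⊤)
    (h1 : ∫⁻ x, ‖iteratedFDeriv ℝ 1 v x‖ₑ ^ 2 < ⊤) (h2 : ∫⁻ x, ‖iteratedFDeriv ℝ 2 v x‖ₑ ^ 2 < ⊤)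
    (x : EuclideanSpace ℝ (Fin 3)) (ϱ : ℝ) :
    ∫⁻ y in ball x ϱ, ‖v y‖ₑ ^ 3 ≤
      volume (ball x ϱ) ^ (1 / 2 : ℝ) *
        ((SNormLESNormFDerivOfEqConst (EuclideanSpace ℝ (Fin 3)) (volume : Measure (EuclideanSpace ℝ (Fin 3))) 2 : ℝ≥0∞) ^ (3 : ℝ) * (∫⁻ y, ‖curl v y‖ₑ ^ 2) ^ (3 / 2 : ℝ)) := by
  have hv1 : ContDiff ℝ 1 v := hv.of_le (by norm_cast)
  have hvm : AEMeasurable (fun y => ‖v y‖ₑ ^ 3) (volume.restrict (ball x ϱ)) :=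
    (hv.continuous.measurable.enorm.pow_const 3).aemeasurable
  -- Hölder on the ball against the constant `1`
  have hH := ENNReal.lintegral_mul_le_Lp_mul_Lq (volume.restrict (ball x ϱ))
    Real.HolderConjugate.two_two hvm (g := fun _ => (1 : ℝ≥0∞)) aemeasurable_const
  have hfg : (fun y => ‖v y‖ₑ ^ 3) * (fun _ => (1 : ℝ≥0∞)) = fun y => ‖v y‖ₑ ^ 3 := by
    funext y; simp
  rw [hfg] at hH
  have hone : (∫⁻ _ in ball x ϱ, (1 : ℝ≥0∞) ^ (2 : ℝ)) ^ (1 / (2 : ℝ)) = volume (ball x ϱ) ^ (1 / 2 : ℝ) := by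
    simp
  have hsix : ∫⁻ y in ball x ϱ, (‖v y‖ₑ ^ 3) ^ (2 : ℝ) ≤ ∫⁻ y, ‖v y‖ₑ ^ (6 : ℝ) := by
    calc ∫⁻ y in ball x ϱ, (‖v y‖ₑ ^ 3) ^ (2 : ℝ)
        = ∫⁻ y in ball x ϱ, ‖v y‖ₑ ^ (6 : ℝ) := by
          refine lintegral_congr fun y => ?_
          rw [ENNReal.rpow_two, ← pow_mul, show (3 * 2 : ℕ) = 6 by norm_num,
            ← ENNReal.rpow_natCast]
          norm_num
      _ ≤ ∫⁻ y, ‖v y‖ₑ ^ (6 : ℝ) := setLIntegral_le_lintegral _ _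
  -- `∫ ‖v‖⁶ = ‖v‖₆⁶ ≤ (K ‖Dv‖₂)⁶ ≤ K⁶ (∫ ‖curl v‖²)³`
  have h2v : eLpNorm v 2 volume < ⊤ := by
    rw [eLpNorm_eq_lintegral_rpow_enorm_toReal (by norm_num) (by norm_num)]
    refine ENNReal.rpow_lt_top_of_nonneg (by norm_num) (ne_of_lt ?_)
    have : ∫⁻ y, ‖v y‖ₑ ^ ((2 : ℝ≥0∞).toReal) = ∫⁻ y, ‖v y‖ₑ ^ 2 := by
      refine lintegral_congr fun y => ?_
      rw [ENNReal.toReal_ofNat, ENNReal.rpow_two]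
    rw [this]; exact h0
  have hSob := eLpNorm_six_le_eLpNorm_fderiv_two (volume : Measure (EuclideanSpace ℝ (Fin 3)))
    finrank_euclideanSpace_fin hv1 h2v
  have hD : eLpNorm (fderiv ℝ v) 2 volume ≤ (∫⁻ y, ‖curl v y‖ₑ ^ 2) ^ (1 / 2 : ℝ) := by
    rw [eLpNorm_eq_lintegral_rpow_enorm_toReal (by norm_num) (by norm_num), ENNReal.toReal_ofNat]
    refine ENNReal.rpow_le_rpow ?_ (by norm_num)
    rw [← lintegral_frobeniusNormSq_fderiv_eq_lintegral_curl_sq hv hdiv h0 h1 h2]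
    refine lintegral_mono fun y => ?_
    rw [ENNReal.rpow_two, ← ofReal_norm, ← ENNReal.ofReal_pow (norm_nonneg _)]
    exact ENNReal.ofReal_le_ofReal (sq_opNorm_le_frobeniusNormSq _)
  have h6eq : ∫⁻ y, ‖v y‖ₑ ^ (6 : ℝ) = eLpNorm v 6 volume ^ (6 : ℝ) := by
    rw [eLpNorm_eq_lintegral_rpow_enorm_toReal (by norm_num) (by norm_num), ENNReal.toReal_ofNat,
      ← ENNReal.rpow_mul]
    norm_num
  have h6le : eLpNorm v 6 volume ^ (6 : ℝ) ≤
      (SNormLESNormFDerivOfEqConst (EuclideanSpace ℝ (Fin 3)) (volume : Measure (EuclideanSpace ℝ (Fin 3))) 2 : ℝ≥0∞) ^ (6 : ℝ) * (∫⁻ y, ‖curl v y‖ₑ ^ 2) ^ (3 : ℝ) := by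
    calc eLpNorm v 6 volume ^ (6 : ℝ)
        ≤ ((SNormLESNormFDerivOfEqConst (EuclideanSpace ℝ (Fin 3)) (volume : Measure (EuclideanSpace ℝ (Fin 3))) 2 : ℝ≥0∞) * (∫⁻ y, ‖curl v y‖ₑ ^ 2) ^ (1 / 2 : ℝ)) ^ (6 : ℝ) :=
          ENNReal.rpow_le_rpow (hSob.trans (mul_le_mul' le_rfl hD)) (by norm_num)
      _ = (SNormLESNormFDerivOfEqConst (EuclideanSpace ℝ (Fin 3)) (volume : Measure (EuclideanSpace ℝ (Fin 3))) 2 : ℝ≥0∞) ^ (6 : ℝ) * (∫⁻ y, ‖curl v y‖ₑ ^ 2) ^ (3 : ℝ) := by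
          rw [ENNReal.mul_rpow_of_nonneg _ _ (by norm_num), ← ENNReal.rpow_mul]
          norm_num
  -- assemble
  calc ∫⁻ y in ball x ϱ, ‖v y‖ₑ ^ 3
      ≤ (∫⁻ y in ball x ϱ, (‖v y‖ₑ ^ 3) ^ (2 : ℝ)) ^ (1 / (2 : ℝ)) *
          (∫⁻ _ in ball x ϱ, (1 : ℝ≥0∞) ^ (2 : ℝ)) ^ (1 / (2 : ℝ)) := hH
    _ ≤ ((SNormLESNormFDerivOfEqConst (EuclideanSpace ℝ (Fin 3)) (volume : Measure (EuclideanSpace ℝ (Fin 3))) 2 : ℝ≥0∞) ^ (6 : ℝ) * (∫⁻ y, ‖curl v y‖ₑ ^ 2) ^ (3 : ℝ)) ^ (1 / (2 : ℝ)) *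
          volume (ball x ϱ) ^ (1 / 2 : ℝ) := by
        rw [hone]
        gcongr
        exact hsix.trans (h6eq.le.trans h6le)
    _ = volume (ball x ϱ) ^ (1 / 2 : ℝ) *
          ((SNormLESNormFDerivOfEqConst (EuclideanSpace ℝ (Fin 3)) (volume : Measure (EuclideanSpace ℝ (Fin 3))) 2 : ℝ≥0∞) ^ (3 : ℝ) * (∫⁻ y, ‖curl v y‖ₑ ^ 2) ^ (3 / 2 : ℝ)) := by
        rw [mul_comm, ENNReal.mul_rpow_of_nonneg _ _ (by norm_num), ← ENNReal.rpow_mul,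
          ← ENNReal.rpow_mul]
        norm_num

/-! ### Along a first blow-up: the slices are smooth, decaying, with finite Sobolev norms -/

/-- **Sobolev finiteness of every slice before the blow-up time** (Tao's cover on closed sub-slabs): for a
classical solution on `[0,T)`, Leray–Hopf from a rapidly decaying datum, every `‖Dⁿ u(t)‖₂` is finite for
`t ∈ [0,T)`. [cite: Tao2011, Cor. 11.1 (proof)] -/
theorem lintegral_iteratedFDeriv_sq_lt_top {ν T : ℝ} (hν : 0 < ν)
    {u : ℝ → EuclideanSpace ℝ (Fin 3) → EuclideanSpace ℝ (Fin 3)} {p : ℝ → EuclideanSpace ℝ (Fin 3) → ℝ}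
    (hcl : IsClassicalNSSolutionOn (Ico 0 T) ν 0 u p) (hLH : IsLerayHopfOn T ν 0 (u 0) u)
    (hdec : HasRapidSpatialDecay (u 0)) {t : ℝ} (ht : t ∈ Ico 0 T) (n : ℕ) :
    ∫⁻ x, ‖iteratedFDeriv ℝ n (u t) x‖ₑ ^ 2 < ⊤ := by
  set T₁ : ℝ := (t + T) / 2 with hT₁
  have hT₁pos : 0 < T₁ := by rw [hT₁]; linarith [ht.1, ht.2]
  have htT₁ : t ≤ T₁ := by rw [hT₁]; linarith [ht.2]
  have hT₁T : T₁ < T := by rw [hT₁]; linarith [ht.2]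
  have hcl₁ : IsClassicalNSSolutionOn (Icc 0 T₁) ν 0 u p :=
    hcl.mono (fun s hs => ⟨hs.1, lt_of_le_of_lt hs.2 hT₁T⟩) (uniqueDiffOn_Icc hT₁pos)
  have hfe : ∃ C' : ℝ≥0, ∀ s ∈ Icc 0 T₁, ∫⁻ x, ‖u s x‖ₑ ^ 2 ≤ C' := by
    refine ⟨(2 * VectorCalculus.kineticEnergy (u 0)).toNNReal, fun s hs => ?_⟩
    have h := hLH.eEnergy_le_datum hν.le (t := s) ⟨hs.1, hs.2.trans hT₁T.le⟩
    exact h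
  obtain ⟨C, hC⟩ := tao2011_hasBoundedSobolevNormsOn_holds hν hT₁pos hcl₁ hfe hdec n
  exact lt_of_le_of_lt (hC t ⟨ht.1, htT₁⟩) ENNReal.coe_lt_top

/-! ### No concentration below the enstrophy scale -/

/-- **No `L³`-concentration below the enstrophy scale (unconditional, every first blow-up, every time).**
There is an absolute `c₀ > 0` such that for every `ν, T > 0`, every maximal classical solution `u` on `[0,T)`
that is Leray–Hopf from its rapidly decaying datum, every threshold `ε₀ > 0`, time `t ∈ [0,T)`, centre `x` and
radius `r > 0`: if `r · Z(t) ≤ c₀ ε₀²`, `Z(t) = ∫ |curl u(t)|²` the enstrophy, then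
`∫_{B(x,2r)} |u(t)|³ < ε₀³` — the ball is NOT `ε₀`-concentrating in the sense of the registered stub
`stub_uniformSparseness` (S2). (`c₀ = c₁²`, `c₁ = 1/(2M+2)`, `M = K³ √(8|B₁|)`.) [folklore] -/
theorem no_concentration_below_enstrophy_scale :
    ∃ c₀ : ℝ, 0 < c₀ ∧ ∀ (ν T : ℝ), 0 < ν → 0 < T →
      ∀ (u : ℝ → EuclideanSpace ℝ (Fin 3) → EuclideanSpace ℝ (Fin 3))
        (p : ℝ → EuclideanSpace ℝ (Fin 3) → ℝ),
      IsMaximalSmoothSolution ν 0 u p T → IsLerayHopfOn T ν 0 (u 0) u →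
      HasRapidSpatialDecay (u 0) →
      ∀ ε₀ : ℝ, 0 < ε₀ → ∀ t ∈ Set.Ico 0 T, ∀ (x : EuclideanSpace ℝ (Fin 3)) (r : ℝ), 0 < r →
        r * (∫⁻ y, ‖curl (u t) y‖ₑ ^ 2).toReal ≤ c₀ * ε₀ ^ 2 →
        ∫⁻ y in Metric.ball x (2 * r), ‖u t y‖ₑ ^ 3 < ENNReal.ofReal (ε₀ ^ 3) := by
  -- the absolute constants
  set Kₑ : ℝ≥0∞ := (SNormLESNormFDerivOfEqConst (EuclideanSpace ℝ (Fin 3))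
    (volume : Measure (EuclideanSpace ℝ (Fin 3))) 2 : ℝ≥0∞) with hKₑ
  set V₁ : ℝ≥0∞ := volume (ball (0 : EuclideanSpace ℝ (Fin 3)) 1) with hV₁
  have hV₁top : V₁ ≠ ⊤ := measure_ball_lt_top.ne
  set M : ℝ≥0∞ := Kₑ ^ (3 : ℝ) * (ENNReal.ofReal 8 * V₁) ^ (1 / 2 : ℝ) with hM
  have hMtop : M ≠ ⊤ := by
    refine ENNReal.mul_ne_top (ENNReal.rpow_ne_top_of_nonneg (by norm_num) ENNReal.coe_ne_top)
      (ENNReal.rpow_ne_top_of_nonneg (by norm_num) (ENNReal.mul_ne_top ENNReal.ofReal_ne_top hV₁top))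
  set Mr : ℝ := M.toReal with hMr
  have hMr0 : 0 ≤ Mr := ENNReal.toReal_nonneg
  set c₁ : ℝ := 1 / (2 * Mr + 2) with hc₁
  have hc₁pos : 0 < c₁ := by rw [hc₁]; positivity
  have hc₁le : c₁ ≤ 1 := by
    rw [hc₁, div_le_one (by positivity)]; linarith
  have hMc₁ : Mr * c₁ ^ 3 ≤ 1 / 2 := by
    have h3 : c₁ ^ 3 ≤ c₁ := by
      have := pow_le_pow_of_le_one hc₁pos.le hc₁le (show 1 ≤ 3 by norm_num)
      simpa using this
    calc Mr * c₁ ^ 3 ≤ Mr * c₁ := mul_le_mul_of_nonneg_left h3 hMr0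
      _ = Mr / (2 * Mr + 2) := by rw [hc₁]; ring
      _ ≤ 1 / 2 := by
          rw [div_le_iff₀ (by positivity)]; linarith
  refine ⟨c₁ ^ 2, by positivity, ?_⟩
  intro ν T hν hT u p hmax hLH hdec ε₀ hε₀ t ht x r hr hrZ
  have hcl : IsClassicalNSSolutionOn (Ico 0 T) ν 0 u p := hmax.1
  -- slice data
  have hn := lintegral_iteratedFDeriv_sq_lt_top hν hcl hLH hdec ht
  have hv : ContDiff ℝ 2 (u t) := (hcl.contDiff_velocity ht).of_le (by norm_cast)
  have h0 : ∫⁻ y, ‖u t y‖ₑ ^ 2 < ⊤ := by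
    refine lt_of_le_of_lt (le_of_eq (lintegral_congr fun y => ?_)) (hn 0)
    rw [← ofReal_norm, ← norm_iteratedFDeriv_zero (𝕜 := ℝ) (f := u t), ofReal_norm]
  set Z : ℝ≥0∞ := ∫⁻ y, ‖curl (u t) y‖ₑ ^ 2 with hZ
  have hZtop : Z ≠ ⊤ :=
    (lt_of_le_of_lt (lintegral_curl_sq_le (u t)) (ENNReal.mul_lt_top ENNReal.ofReal_lt_top (hn 1))).ne
  -- the static bound on the ball `B(x, 2r)`
  have hstat := setLIntegral_ball_norm_cube_le hv (hcl.divFree t ht) h0 (hn 1) (hn 2) x (2 * r)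
  -- the volume of the ball
  have hvol : volume (ball x (2 * r)) = ENNReal.ofReal 8 * ENNReal.ofReal r ^ 3 * V₁ := by
    rw [Measure.addHaar_ball_of_pos _ _ (by positivity : (0 : ℝ) < 2 * r), finrank_euclideanSpace_fin,
      show (2 * r) ^ 3 = 8 * r ^ 3 by ring, ENNReal.ofReal_mul (by norm_num),
      ENNReal.ofReal_pow hr.le]
  -- `r · Z ≤ (c₁ ε₀)²` in `ℝ≥0∞`
  have hrZ' : ENNReal.ofReal r * Z ≤ ENNReal.ofReal (c₁ * ε₀) ^ 2 := by
    rw [← ENNReal.ofReal_toReal hZtop, ← ENNReal.ofReal_mul hr.le,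
      ← ENNReal.ofReal_pow (by positivity : 0 ≤ c₁ * ε₀)]
    refine ENNReal.ofReal_le_ofReal ?_
    calc r * Z.toReal ≤ c₁ ^ 2 * ε₀ ^ 2 := hrZ
      _ = (c₁ * ε₀) ^ 2 := by ring
  -- rewrite the static bound as `M · ((ofReal r · Z)³)^{1/2}`
  have hkey : volume (ball x (2 * r)) ^ (1 / 2 : ℝ) * (Kₑ ^ (3 : ℝ) * Z ^ (3 / 2 : ℝ)) =
      M * ((ENNReal.ofReal r * Z) ^ 3) ^ (1 / 2 : ℝ) := by
    have hZ32 : Z ^ (3 / 2 : ℝ) = (Z ^ 3) ^ (1 / 2 : ℝ) := by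
      rw [← ENNReal.rpow_natCast, ← ENNReal.rpow_mul]; norm_num
    rw [hZ32, hvol, hM, mul_pow, ENNReal.mul_rpow_of_nonneg _ (Z ^ 3) (by norm_num),
      show ENNReal.ofReal 8 * ENNReal.ofReal r ^ 3 * V₁ = (ENNReal.ofReal 8 * V₁) * ENNReal.ofReal r ^ 3 by ring,
      ENNReal.mul_rpow_of_nonneg _ (ENNReal.ofReal r ^ 3) (by norm_num)]
    ring
  -- the chain
  have hε3 : ((ENNReal.ofReal (c₁ * ε₀) ^ 2) ^ 3) ^ (1 / 2 : ℝ) = ENNReal.ofReal (c₁ * ε₀) ^ 3 := by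
    rw [← pow_mul, ← ENNReal.rpow_natCast, ← ENNReal.rpow_mul, ← ENNReal.rpow_natCast]; norm_num
  have hle : ∫⁻ y in ball x (2 * r), ‖u t y‖ₑ ^ 3 ≤ M * ENNReal.ofReal (c₁ * ε₀) ^ 3 := by
    calc ∫⁻ y in ball x (2 * r), ‖u t y‖ₑ ^ 3
        ≤ volume (ball x (2 * r)) ^ (1 / 2 : ℝ) * (Kₑ ^ (3 : ℝ) * Z ^ (3 / 2 : ℝ)) := hstat
      _ = M * ((ENNReal.ofReal r * Z) ^ 3) ^ (1 / 2 : ℝ) := hkey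
      _ ≤ M * ((ENNReal.ofReal (c₁ * ε₀) ^ 2) ^ 3) ^ (1 / 2 : ℝ) := by gcongr
      _ = M * ENNReal.ofReal (c₁ * ε₀) ^ 3 := by rw [hε3]
  -- back to real numbers
  have hfin : M * ENNReal.ofReal (c₁ * ε₀) ^ 3 = ENNReal.ofReal (Mr * (c₁ ^ 3 * ε₀ ^ 3)) := by
    rw [ENNReal.ofReal_mul hMr0, hMr, ENNReal.ofReal_toReal hMtop,
      ← ENNReal.ofReal_pow (by positivity : 0 ≤ c₁ * ε₀), mul_pow]
  refine lt_of_le_of_lt (hle.trans_eq hfin) ((ENNReal.ofReal_lt_ofReal_iff (by positivity)).2 ?_)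
  have hε₀3 : 0 < ε₀ ^ 3 := by positivity
  calc Mr * (c₁ ^ 3 * ε₀ ^ 3) = Mr * c₁ ^ 3 * ε₀ ^ 3 := by ring
    _ ≤ 1 / 2 * ε₀ ^ 3 := mul_le_mul_of_nonneg_right hMc₁ hε₀3.le
    _ < ε₀ ^ 3 := by linarith

/-- **Corollary in the currency of the registered stub `stub_uniformSparseness` (S2):** with the absolute `c₀`
of `no_concentration_below_enstrophy_scale`, at every time `t ∈ [0,T)` and every scale `r > 0` with
`r · Z(t) ≤ c₀ ε₀²`, every finite family of centres whose `2r`-balls `ε₀`-concentrate is EMPTY (so the S2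
count is `0 ≤ N₀` there, whatever `N₀`). The open regime of S2 at time `t` is therefore confined to scales
`r > c₀ ε₀² / Z(t)` (and, by `SparsenessMacroscopic`, `r < r_min`). [folklore] -/
theorem card_eq_zero_below_enstrophy_scale :
    ∃ c₀ : ℝ, 0 < c₀ ∧ ∀ (ν T : ℝ), 0 < ν → 0 < T →
      ∀ (u : ℝ → EuclideanSpace ℝ (Fin 3) → EuclideanSpace ℝ (Fin 3))
        (p : ℝ → EuclideanSpace ℝ (Fin 3) → ℝ),
      IsMaximalSmoothSolution ν 0 u p T → IsLerayHopfOn T ν 0 (u 0) u →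
      HasRapidSpatialDecay (u 0) →
      ∀ ε₀ : ℝ, 0 < ε₀ → ∀ t ∈ Set.Ico 0 T, ∀ r : ℝ, 0 < r →
        r * (∫⁻ y, ‖curl (u t) y‖ₑ ^ 2).toReal ≤ c₀ * ε₀ ^ 2 →
        ∀ F : Finset (EuclideanSpace ℝ (Fin 3)),
          (∀ x ∈ F, ENNReal.ofReal (ε₀ ^ 3) ≤ ∫⁻ y in Metric.ball x (2 * r), ‖u t y‖ₑ ^ 3) →
          F.card = 0 := by
  obtain ⟨c₀, hc₀, h⟩ := no_concentration_below_enstrophy_scale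
  refine ⟨c₀, hc₀, fun ν T hν hT u p hmax hLH hdec ε₀ hε₀ t ht r hr hrZ F hF => ?_⟩
  rw [Finset.card_eq_zero, Finset.eq_empty_iff_forall_notMem]
  intro x hx
  exact absurd (hF x hx) (not_le.2 (h ν T hν hT u p hmax hLH hdec ε₀ hε₀ t ht x r hr hrZ))

end Summit.NavierStokesRegularity.NavierStokesRegularity.Theorems.EnstrophyQuarterLaw.EnstrophyScale

end
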